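import Mathlib

/-!
# The downward-injection lemma (blind cell PercRepro2, p3 g15, 2026-08-27; `proofs/P3-CPNC.md` §10i)

For every up-set `U` of the subsets of a finite ground set `s` there is an injection
`φ : U → {y ⊆ s : s ∖ y ∈ U}` with `φ x ⊆ x` — an injection of an up-set into its complement image
along containment.  Proof by induction on the ground set: split `U` by a new element `a` into
`U₀ = {x ∈ U : a ∉ x}` and `U₁ = {x ∖ {a} : x ∈ U, a ∈ x}` (both up-sets of the smaller ground set,
`U₀ ⊆ U₁`), take the two injections by induction, send `x ∌ a` to `φ₀ x`, and `x = x' ∪ {a}` to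
`φ₁ x'` when that avoids `φ₀ (U₀)` and to `φ₁ x' ∪ {a}` otherwise.  It is the environment-free core
of the local Hall problem of the switching move `m9` (sources = the connected spanning edge sets of a
cluster, an up-set; targets ⊇ the complement image; closures of edges as the moves).  Own work,
Mathlib only; standard axioms.
-/

namespace Summit.Ventures.PercRepro2

namespace DownwardInjection

open Finset

variable {α : Type*} [DecidableEq α]

/-- `U` is an up-set of the subsets of `s`: its members lie in `s` and it is closed upwards in `s`. -/
def IsUpSetIn (s : Finset α) (U : Finset (Finset α)) : Prop :=
  (∀ x ∈ U, x ⊆ s) ∧ ∀ x ∈ U, ∀ y, y ⊆ s → x ⊆ y → y ∈ U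

/-- A downward injection of `U` into its complement image in `s`. -/
def IsDownwardInjection (s : Finset α) (U : Finset (Finset α)) (φ : Finset α → Finset α) : Prop :=
  Set.InjOn φ (U : Set (Finset α)) ∧ ∀ x ∈ U, φ x ⊆ x ∧ s \ φ x ∈ U

/-- The part of `U` avoiding `a`. -/
def part0 (a : α) (U : Finset (Finset α)) : Finset (Finset α) := U.filter (fun x => a ∉ x)

/-- The part of `U` containing `a`, with `a` removed. -/
def part1 (a : α) (U : Finset (Finset α)) : Finset (Finset α) :=
  (U.filter (fun x => a ∈ x)).image (fun x => x.erase a)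

/-- Membership in `part0`. -/
lemma mem_part0 {a : α} {U : Finset (Finset α)} {x : Finset α} :
    x ∈ part0 a U ↔ x ∈ U ∧ a ∉ x := by
  simp [part0]

/-- Membership in `part1`. -/
lemma mem_part1 {a : α} {U : Finset (Finset α)} {y : Finset α} :
    y ∈ part1 a U ↔ ∃ x ∈ U, a ∈ x ∧ x.erase a = y := by
  simp only [part1, mem_image, mem_filter]
  constructor
  · rintro ⟨x, ⟨hx, ha⟩, rfl⟩; exact ⟨x, hx, ha, rfl⟩
  · rintro ⟨x, hx, ha, rfl⟩; exact ⟨x, ⟨hx, ha⟩, rfl⟩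

/-- Membership in `part1` for a set not containing `a`: `y ∈ part1 a U ↔ insert a y ∈ U`. -/
lemma mem_part1_of_not_mem {a : α} {U : Finset (Finset α)} {y : Finset α} (hy : a ∉ y) :
    y ∈ part1 a U ↔ insert a y ∈ U := by
  rw [mem_part1]
  constructor
  · rintro ⟨x, hx, ha, rfl⟩
    rw [insert_erase ha]; exact hx
  · intro h
    exact ⟨insert a y, h, mem_insert_self a y, erase_insert hy⟩

/-- `part0` is an up-set of the smaller ground set. -/
lemma part0_isUpSetIn {s : Finset α} {a : α} (ha : a ∉ s) {U : Finset (Finset α)}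
    (hU : IsUpSetIn (insert a s) U) : IsUpSetIn s (part0 a U) := by
  refine ⟨fun x hx => ?_, fun x hx y hys hxy => ?_⟩
  · rw [mem_part0] at hx
    intro b hb
    have := hU.1 x hx.1 hb
    rw [mem_insert] at this
    rcases this with rfl | h
    · exact absurd hb hx.2
    · exact h
  · rw [mem_part0] at hx ⊢
    refine ⟨hU.2 x hx.1 y (hys.trans (subset_insert a s)) hxy, fun hay => ha (hys hay)⟩

/-- `part1` is an up-set of the smaller ground set. -/
lemma part1_isUpSetIn {s : Finset α} {a : α} (ha : a ∉ s) {U : Finset (Finset α)}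
    (hU : IsUpSetIn (insert a s) U) : IsUpSetIn s (part1 a U) := by
  refine ⟨fun y hy => ?_, fun y hy z hzs hyz => ?_⟩
  · obtain ⟨x, hx, hax, rfl⟩ := mem_part1.1 hy
    intro b hb
    rw [mem_erase] at hb
    have := hU.1 x hx hb.2
    rw [mem_insert] at this
    rcases this with rfl | h
    · exact absurd rfl hb.1
    · exact h
  · obtain ⟨x, hx, hax, rfl⟩ := mem_part1.1 hy
    have hza : a ∉ z := fun h => ha (hzs h)
    rw [mem_part1_of_not_mem hza]
    refine hU.2 x hx (insert a z) (insert_subset_insert a hzs) ?_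
    intro b hb
    by_cases hba : b = a
    · rw [hba]; exact mem_insert_self a z
    · exact mem_insert_of_mem (hyz (mem_erase.2 ⟨hba, hb⟩))

/-- `part0 ⊆ part1` for an up-set. -/
lemma part0_subset_part1 {s : Finset α} {a : α} {U : Finset (Finset α)}
    (hU : IsUpSetIn (insert a s) U) : part0 a U ⊆ part1 a U := by
  intro x hx
  rw [mem_part0] at hx
  rw [mem_part1_of_not_mem hx.2]
  have hxs : x ⊆ s := by
    intro b hb
    have := hU.1 x hx.1 hb
    rw [mem_insert] at this
    rcases this with rfl | h
    · exact absurd hb hx.2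
    · exact h
  exact hU.2 x hx.1 (insert a x) (insert_subset_insert a hxs) (subset_insert a x)

/-- The combined map. -/
def combine (a : α) (U₀ : Finset (Finset α)) (φ₀ φ₁ : Finset α → Finset α) (x : Finset α) :
    Finset α :=
  if a ∈ x then (if φ₁ (x.erase a) ∈ U₀.image φ₀ then insert a (φ₁ (x.erase a)) else φ₁ (x.erase a))
  else φ₀ x

/-- **The downward-injection lemma.**  Every up-set `U` of the subsets of a finite set `s` admits an
injection `φ` into its complement image `{y : s ∖ y ∈ U}` with `φ x ⊆ x`. -/
theorem exists_downward_injection (s : Finset α) :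
    ∀ U : Finset (Finset α), IsUpSetIn s U → ∃ φ : Finset α → Finset α, IsDownwardInjection s U φ := by
  induction s using Finset.induction_on with
  | empty =>
    intro U hU
    refine ⟨id, ?_, fun x hx => ⟨subset_refl _, ?_⟩⟩
    · exact Set.injOn_id _
    · have hx0 : x = ∅ := subset_empty.1 (hU.1 x hx)
      subst hx0
      simpa using hx
  | insert a s ha ih =>
    intro U hU
    obtain ⟨φ₀, hφ₀⟩ := ih (part0 a U) (part0_isUpSetIn ha hU)
    obtain ⟨φ₁, hφ₁⟩ := ih (part1 a U) (part1_isUpSetIn ha hU)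
    refine ⟨combine a (part0 a U) φ₀ φ₁, ?_, ?_⟩
    · -- injectivity
      intro x hx y hy hxy
      simp only [Finset.mem_coe] at hx hy
      simp only [combine] at hxy
      -- facts about the images
      have hφ₀notmem : ∀ z ∈ part0 a U, a ∉ φ₀ z := fun z hz hz' =>
        (mem_part0.1 hz).2 ((hφ₀.2 z hz).1 hz')
      have hφ₁notmem : ∀ z ∈ part1 a U, a ∉ φ₁ z := fun z hz hz' => by
        have := (hφ₁.2 z hz).1 hz'
        obtain ⟨w, _, _, rfl⟩ := mem_part1.1 hz
        exact (mem_erase.1 this).1 rfl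
      have hx' : a ∈ x → x.erase a ∈ part1 a U := fun hax => mem_part1.2 ⟨x, hx, hax, rfl⟩
      have hy' : a ∈ y → y.erase a ∈ part1 a U := fun hay => mem_part1.2 ⟨y, hy, hay, rfl⟩
      have hx0 : a ∉ x → x ∈ part0 a U := fun hax => mem_part0.2 ⟨hx, hax⟩
      have hy0 : a ∉ y → y ∈ part0 a U := fun hay => mem_part0.2 ⟨hy, hay⟩
      by_cases hax : a ∈ x <;> by_cases hay : a ∈ y
      · -- both contain a
        simp only [hax, hay, if_true] at hxy
        by_cases h1 : φ₁ (x.erase a) ∈ (part0 a U).image φ₀ <;>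
          by_cases h2 : φ₁ (y.erase a) ∈ (part0 a U).image φ₀
        · simp only [h1, h2, if_true] at hxy
          have : φ₁ (x.erase a) = φ₁ (y.erase a) := by
            have hxa := hφ₁notmem _ (hx' hax); have hya := hφ₁notmem _ (hy' hay)
            have := congrArg (fun t => t.erase a) hxy
            simpa [erase_insert hxa, erase_insert hya] using this
          have := hφ₁.1 (hx' hax) (hy' hay) this
          rw [← insert_erase hax, ← insert_erase hay, this]
        · simp only [h1, h2, if_true, if_false] at hxy
          exact absurd (hxy ▸ mem_insert_self a _) (hφ₁notmem _ (hy' hay))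
        · simp only [h1, h2, if_true, if_false] at hxy
          exact absurd (hxy.symm ▸ mem_insert_self a _) (hφ₁notmem _ (hx' hax))
        · simp only [h1, h2, if_false] at hxy
          have := hφ₁.1 (hx' hax) (hy' hay) hxy
          rw [← insert_erase hax, ← insert_erase hay, this]
      · -- a ∈ x, a ∉ y
        simp only [hax, hay, if_true, if_false] at hxy
        by_cases h1 : φ₁ (x.erase a) ∈ (part0 a U).image φ₀
        · simp only [h1, if_true] at hxy
          exact absurd (hxy ▸ mem_insert_self a _) (hφ₀notmem _ (hy0 hay))
        · simp only [h1, if_false] at hxy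
          exact absurd (mem_image.2 ⟨y, hy0 hay, hxy.symm⟩) h1
      · -- a ∉ x, a ∈ y
        simp only [hax, hay, if_true, if_false] at hxy
        by_cases h2 : φ₁ (y.erase a) ∈ (part0 a U).image φ₀
        · simp only [h2, if_true] at hxy
          exact absurd (hxy.symm ▸ mem_insert_self a _) (hφ₀notmem _ (hx0 hax))
        · simp only [h2, if_false] at hxy
          exact absurd (mem_image.2 ⟨x, hx0 hax, hxy⟩) h2
      · -- neither contains a
        simp only [hax, hay, if_false] at hxy
        exact hφ₀.1 (hx0 hax) (hy0 hay) hxy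
    · -- the image conditions
      intro x hx
      simp only [combine]
      by_cases hax : a ∈ x
      · simp only [hax, if_true]
        have hx' : x.erase a ∈ part1 a U := mem_part1.2 ⟨x, hx, hax, rfl⟩
        obtain ⟨hsub, hmem⟩ := hφ₁.2 _ hx'
        have hφ₁a : a ∉ φ₁ (x.erase a) := fun h => (mem_erase.1 (hsub h)).1 rfl
        by_cases h1 : φ₁ (x.erase a) ∈ (part0 a U).image φ₀
        · simp only [h1, if_true]
          refine ⟨?_, ?_⟩
          · exact insert_subset (by exact hax) (hsub.trans (erase_subset a x))
          · -- (insert a s) \ insert a z = s \ z ; s \ z ∈ part0 a U ⊆ U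
            obtain ⟨w, hw, hwz⟩ := mem_image.1 h1
            have hz0 : s \ φ₁ (x.erase a) ∈ part0 a U := by
              rw [← hwz]; exact (hφ₀.2 w hw).2
            have heq : insert a s \ insert a (φ₁ (x.erase a)) = s \ φ₁ (x.erase a) := by
              ext b; simp only [mem_sdiff, mem_insert]
              constructor
              · rintro ⟨hb1 | hb1, hb2⟩
                · exact absurd (Or.inl hb1) hb2
                · exact ⟨hb1, fun h => hb2 (Or.inr h)⟩
              · rintro ⟨hb1, hb2⟩
                exact ⟨Or.inr hb1, fun h => by
                  rcases h with rfl | h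
                  · exact ha hb1
                  · exact hb2 h⟩
            rw [heq]
            exact (mem_part0.1 hz0).1
        · simp only [h1, if_false]
          refine ⟨hsub.trans (erase_subset a x), ?_⟩
          -- (insert a s) \ z = insert a (s \ z), and s \ z ∈ part1 a U means insert a (s \ z) ∈ U
          have heq : insert a s \ φ₁ (x.erase a) = insert a (s \ φ₁ (x.erase a)) := by
            ext b; simp only [mem_sdiff, mem_insert]
            constructor
            · rintro ⟨hb1 | hb1, hb2⟩
              · exact Or.inl hb1
              · exact Or.inr ⟨hb1, hb2⟩
            · rintro (rfl | ⟨hb1, hb2⟩)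
              · exact ⟨Or.inl rfl, hφ₁a⟩
              · exact ⟨Or.inr hb1, hb2⟩
          rw [heq]
          have hna : a ∉ s \ φ₁ (x.erase a) := fun h => ha (mem_sdiff.1 h).1
          exact (mem_part1_of_not_mem hna).1 hmem
      · simp only [hax, if_false]
        have hx0 : x ∈ part0 a U := mem_part0.2 ⟨hx, hax⟩
        obtain ⟨hsub, hmem⟩ := hφ₀.2 x hx0
        refine ⟨hsub, ?_⟩
        have hφ₀a : a ∉ φ₀ x := fun h => hax (hsub h)
        have heq : insert a s \ φ₀ x = insert a (s \ φ₀ x) := by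
          ext b; simp only [mem_sdiff, mem_insert]
          constructor
          · rintro ⟨hb1 | hb1, hb2⟩
            · exact Or.inl hb1
            · exact Or.inr ⟨hb1, hb2⟩
          · rintro (rfl | ⟨hb1, hb2⟩)
            · exact ⟨Or.inl rfl, hφ₀a⟩
            · exact ⟨Or.inr hb1, hb2⟩
        rw [heq]
        exact hU.2 _ (mem_part0.1 hmem).1 _ (insert_subset_insert a (sdiff_subset)) (subset_insert _ _)

end DownwardInjection

end Summit.Ventures.PercRepro2
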